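import Literature.AlgebraicTopology.SingularHomology.MayerVietorisExactness
import Literature.AlgebraicTopology.SingularHomology.SimplyConnectedH1
import HarnessLib

/-!
# Mayer–Vietoris with vanishing first homology: lifting classes to the intersection

Helper layer `helper_degree_mv` of the brick `helper_sliceGluing_vanishingDegree` (apex leaf F0,
the degree lemma; homological core `helper_degree_core`) of line `Sketch`, crux
`SblfDescent.RungOne` (crux item stmt-SmoothPoincare4-18531).

For an open cover `X = U ∪ V` the Mayer–Vietoris sequence
`H₁(U ∩ V) →φ H₁(U) ⊕ H₁(V) →ψ H₁(X)` is exact (`mayerVietoris.exact₁_holds`,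
`MayerVietorisExactness.lean`; Hatcher, §2.2 p. 149).  If `H₁(X; ℤ) = 0` — e.g. `X` simply connected
(`isZero_singularHomology_one_of_simplyConnectedSpace`) — then `ψ = 0`, so `φ` is onto:
**every class of `H₁(V)` is the image of a class of `H₁(U ∩ V)` that dies in `H₁(U)`**
(`helper_degree_mv`, registered; and `helper_degree_mv_of_simplyConnected`).  This is the form
in which the simple connectivity of the total space enters the degree lemma.

## References

* A. Hatcher, *Algebraic Topology* (2002), §2.2 p. 149 (Mayer–Vietoris), Thm. 2A.1.
  [HatcherAT2002]
-/

set_option linter.dupNamespace false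

noncomputable section

open CategoryTheory CategoryTheory.Limits Set Function
open Literature.AlgebraicTopology.SingularHomology

namespace Summit.SmoothPoincare4.SmoothPoincare4.Cruxes.RungOne.Sketch

/-- **Mayer–Vietoris with `H₁(X) = 0`** (registered layer of the degree lemma): for an open cover
`X = U ∪ V` with `H₁(X; ℤ) = 0`, every class `y ∈ H₁(V; ℤ)` is `i_{V*} x` for some
`x ∈ H₁(U ∩ V; ℤ)` with `i_{U*} x = 0`. [cite: HatcherAT2002, §2.2 p. 149] -/
theorem helper_degree_mv : ∀ (X : Type) [TopologicalSpace X] (U V : Set X), IsOpen U → IsOpen V → U ∪ V = Set.univ → IsZero (singularHomology ℤ ℤ X 1) → ∀ y : singularHomology ℤ ℤ ↥V 1, ∃ x : singularHomology ℤ ℤ ↥(U ∩ V) 1, singularHomology.map ℤ ℤ (subsetInclusion (Set.inter_subset_left : U ∩ V ⊆ U)) 1 x = 0 ∧ singularHomology.map ℤ ℤ (subsetInclusion (Set.inter_subset_right : U ∩ V ⊆ V)) 1 x = y := by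
  intro X _ U V hU hV hUV hZ y
  have hint : interior U ∪ interior V = Set.univ := by rw [hU.interior_eq, hV.interior_eq, hUV]
  have hex := mayerVietoris.exact₁_holds ℤ ℤ U V hint 1
  rw [ShortComplex.moduleCat_exact_iff] at hex
  -- the element `(0, y)` of `H₁(U) ⊞ H₁(V)` maps to `0 = H₁(X)`
  set z : ↑(singularHomology ℤ ℤ ↥U 1 ⊞ singularHomology ℤ ℤ ↥V 1) :=
    (biprod.inr : singularHomology ℤ ℤ ↥V 1 ⟶ _) y with hz
  haveI := ModuleCat.subsingleton_of_isZero hZ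
  obtain ⟨x, hx⟩ := hex z (Subsingleton.elim _ _)
  change mayerVietoris.φ ℤ ℤ U V 1 x = z at hx
  refine ⟨-x, ?_, ?_⟩
  · have h1 := congrArg (biprod.fst : singularHomology ℤ ℤ ↥U 1 ⊞ singularHomology ℤ ℤ ↥V 1 ⟶ _) hx
    rw [mayerVietoris.φ, biprod_fst_lift_apply, hz, ← ModuleCat.comp_apply, biprod.inr_fst] at h1
    rw [map_neg, h1]
    simp
  · have h2 := congrArg (biprod.snd : singularHomology ℤ ℤ ↥U 1 ⊞ singularHomology ℤ ℤ ↥V 1 ⟶ _) hx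
    rw [mayerVietoris.φ, biprod_snd_lift_apply, hz, ← ModuleCat.comp_apply, biprod.inr_snd,
      ModuleCat.id_apply] at h2
    rw [map_neg, ← h2]
    simp

/-- **Mayer–Vietoris on a simply connected space**: for an open cover `X = U ∪ V` of a simply
connected `X`, every class of `H₁(V; ℤ)` comes from a class of `H₁(U ∩ V; ℤ)` that dies in
`H₁(U; ℤ)`. [cite: HatcherAT2002, §2.2 p. 149, Thm. 2A.1] -/
theorem helper_degree_mv_of_simplyConnected {X : Type} [TopologicalSpace X] [SimplyConnectedSpace X]
    {U V : Set X} (hU : IsOpen U) (hV : IsOpen V) (hUV : U ∪ V = Set.univ)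
    (y : singularHomology ℤ ℤ ↥V 1) :
    ∃ x : singularHomology ℤ ℤ ↥(U ∩ V) 1,
      singularHomology.map ℤ ℤ (subsetInclusion (Set.inter_subset_left : U ∩ V ⊆ U)) 1 x = 0 ∧
      singularHomology.map ℤ ℤ (subsetInclusion (Set.inter_subset_right : U ∩ V ⊆ V)) 1 x = y :=
  helper_degree_mv X U V hU hV hUV (isZero_singularHomology_one_of_simplyConnectedSpace ℤ ℤ) y

end Summit.SmoothPoincare4.SmoothPoincare4.Cruxes.RungOne.Sketch

end
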